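import Summits.Ventures.PercRepro.SixFourT4Certificate
import Summits.Ventures.PercRepro.SixFourResidueThreeIdentity

/-!
# PercRepro — C-025 at `(6,4)`: the shared numeric lemmas of the two per-pair tails (mine-2 g22, §21.19 / §21.21; p3's 3178)

Elementary facts on `S3`, `delta`, `eps`, `bonus3` (`δ(m+1) = 2δ(m) + C(m,3)`, `C(m,4) ≤ δ(m) ≤ 2^m`, `ε = δ + C(m,3)`), the
`2^x`-versus-polynomial inductions (`1000·g⁴ ≤ 2^g` for `g ≥ 101`, `3c⁴ ≤ 2^c` for `c ≥ 22`, `4c⁴ ≤ 2^c` for `c ≥ 23`,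
`927·2^m ≤ 1000·δ(m)` and `10000·C(m,4) ≤ 1214·2^m` for `m ≥ 12`, the Regime-II base inequalities), Lemma A at `t = 3`
(`F₃(g) ≥ (1799/1000)·2^g`) and at `t = 4` (`Fg(g) ≥ (799/1000)·2^g`) for `g ≥ 101`, the `ρ ≥ ((99 − c)/100)²` bound and
the two Regime-I helpers (`S_of_yterm`, `delta_bounds`).  Imports only landed modules; used by
`SixFourResidueThreeGenericTail` (t = 3) and `SixFourResidueFourGenericTail` (t = 4).
-/

namespace PercRepro.SixFour

/-! ## Elementary facts on `S3`, `delta`, `eps`, `bonus3` -/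

/-- `S₃(m+1) = S₃(m) + S₂(m)` (Pascal). -/
theorem S3_succ (m : ℕ) : S3 (m + 1) = S3 m + S2 m := by
  have h2 : (m + 1).choose 2 = m.choose 1 + m.choose 2 := Nat.choose_succ_succ' m 1
  have h3 : (m + 1).choose 3 = m.choose 2 + m.choose 3 := Nat.choose_succ_succ' m 2
  rw [Nat.choose_one_right] at h2
  unfold S3 S2
  omega

/-- `S₂(m) ≤ S₃(m)`. -/
theorem S2_le_S3 (m : ℕ) : S2 m ≤ S3 m := by
  unfold S2 S3; omega

/-- `S₃(m) ≤ 2^m`. -/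
theorem S3_le_two_pow (m : ℕ) : S3 m ≤ 2 ^ m := by
  induction m with
  | zero => decide
  | succ n ih =>
    rw [S3_succ, pow_succ]
    have := S2_le_S3 n
    omega

/-- `1 + m + C(m,2) ≤ 2^m` (the subtraction in `eps` is exact). -/
theorem S2_le_two_pow' (m : ℕ) : 1 + m + m.choose 2 ≤ 2 ^ m := by
  have h := S3_le_two_pow m
  unfold S3 at h
  omega

/-- `δ(m) = 2^m − S₃(m)` in `ℚ`. -/
theorem delta_cast (m : ℕ) : (delta m : ℚ) = 2 ^ m - S3 m := by
  unfold delta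
  rw [Nat.cast_sub (S3_le_two_pow m)]
  push_cast
  ring

/-- `δ(m+1) = 2·δ(m) + C(m,3)`. -/
theorem delta_succ (m : ℕ) : delta (m + 1) = 2 * delta m + m.choose 3 := by
  have h1 := S3_le_two_pow m
  have h2 := S2_le_S3 m
  unfold delta
  rw [S3_succ, pow_succ]
  unfold S3 S2 at *
  omega

/-- `C(m,4) ≤ δ(m)`. -/
theorem choose_four_le_delta (m : ℕ) : m.choose 4 ≤ delta m := by
  induction m with
  | zero => decide
  | succ n ih =>
    have h4 : (n + 1).choose 4 = n.choose 3 + n.choose 4 := Nat.choose_succ_succ' n 3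
    rw [delta_succ]
    omega

/-- `δ(m) ≤ 2^m`. -/
theorem delta_le_two_pow (m : ℕ) : delta m ≤ 2 ^ m := Nat.sub_le _ _

/-- `ε(m) = δ(m) + C(m,3)` in `ℚ`. -/
theorem eps_cast (m : ℕ) : (eps m : ℚ) = (delta m : ℚ) + m.choose 3 := by
  have h := S2_le_two_pow' m
  unfold eps
  rw [Nat.cast_sub h, delta_cast]
  unfold S3
  push_cast
  ring

/-- `bonus₃(m) = −(3/5)δ(m) + (6/5)C(m,3) + (12/5)C(m,4)`. -/
theorem bonus3_eq (m : ℕ) :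
    bonus3 m = -(3 / 5) * (delta m : ℚ) + 6 / 5 * (m.choose 3 : ℚ) + 12 / 5 * (m.choose 4 : ℚ) := by
  unfold bonus3
  rw [eps_cast]
  ring

/-! ## The `2^x`-versus-polynomial inductions and the two Lemma A's -/

/-- Lemma B: `927·2^m ≤ 1000·δ(m)` for `m ≥ 12` (`δ(12) = 3797`). -/
theorem delta_ge_927 {m : ℕ} (hm : 12 ≤ m) : 927 * 2 ^ m ≤ 1000 * delta m := by
  induction m, hm using Nat.le_induction with
  | base => decide
  | succ n _ ih =>
    rw [delta_succ, pow_succ]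
    omega

/-- `C(m,3) ≤ C(m,4)` for `m ≥ 7`. -/
theorem choose_three_le_choose_four {m : ℕ} (hm : 7 ≤ m) : m.choose 3 ≤ m.choose 4 := by
  have h : m.choose 4 * 4 = m.choose 3 * (m - 3) := Nat.choose_succ_right_eq m 3
  have h4 : m.choose 3 * 4 ≤ m.choose 3 * (m - 3) := Nat.mul_le_mul_left _ (by omega)
  omega

/-- Lemma C′: `10000·C(m,4) ≤ 1214·2^m` for `m ≥ 12` (`C(12,4) = 495`). -/
theorem choose_four_le_1214 {m : ℕ} (hm : 12 ≤ m) : 10000 * m.choose 4 ≤ 1214 * 2 ^ m := by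
  induction m, hm using Nat.le_induction with
  | base => decide
  | succ n hn ih =>
    have h4 : (n + 1).choose 4 = n.choose 3 + n.choose 4 := Nat.choose_succ_succ' n 3
    have h3 := choose_three_le_choose_four (by omega : 7 ≤ n)
    rw [h4, pow_succ]
    omega

/-- `(n+1)^4 ≤ 2·n^4` for `n ≥ 15`. -/
theorem succ_pow_four_le {n : ℕ} (hn : 15 ≤ n) : (n + 1) ^ 4 ≤ 2 * n ^ 4 := by
  have e : (n + 1) ^ 4 = n ^ 4 + 4 * n ^ 3 + 6 * n ^ 2 + 4 * n + 1 := by ring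
  have a : 15 * n ^ 3 ≤ n ^ 4 := by
    calc 15 * n ^ 3 ≤ n * n ^ 3 := Nat.mul_le_mul_right _ hn
      _ = n ^ 4 := by ring
  have b : n ^ 2 ≤ n ^ 3 := Nat.pow_le_pow_right (by omega) (by omega)
  have c : n ≤ n ^ 3 := by
    calc n = n ^ 1 := (pow_one n).symm
      _ ≤ n ^ 3 := Nat.pow_le_pow_right (by omega) (by omega)
  have d : 1 ≤ n ^ 3 := Nat.one_le_pow _ _ (by omega)
  omega

/-- Lemma A′: `1000·g^4 ≤ 2^g` for `g ≥ 101`. -/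
theorem two_pow_ge_thousand {g : ℕ} (hg : 101 ≤ g) : 1000 * g ^ 4 ≤ 2 ^ g := by
  induction g, hg using Nat.le_induction with
  | base => norm_num
  | succ n hn ih =>
    have := succ_pow_four_le (by omega : 15 ≤ n)
    rw [show (2 : ℕ) ^ (n + 1) = 2 * 2 ^ n by ring]
    omega

/-- `3·c^4 ≤ 2^c` for `c ≥ 22` (Regime II-b). -/
theorem two_pow_ge_three_pow_four {c : ℕ} (hc : 22 ≤ c) : 3 * c ^ 4 ≤ 2 ^ c := by
  induction c, hc using Nat.le_induction with
  | base => norm_num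
  | succ n hn ih =>
    have := succ_pow_four_le (by omega : 15 ≤ n)
    rw [show (2 : ℕ) ^ (n + 1) = 2 * 2 ^ n by ring]
    omega

/-- Regime II-a: `(c+1)(1800 + 1500c)·40804 ≤ 17631999·2^c` for `c ≥ 11` (`1799·9801 = 17631999`, `202² = 40804`). -/
theorem regII_a {c : ℕ} (hc : 11 ≤ c) : (c + 1) * (1800 + 1500 * c) * 40804 ≤ 17631999 * 2 ^ c := by
  induction c, hc using Nat.le_induction with
  | base => norm_num
  | succ n hn ih =>
    have h : (n + 2) * (1800 + 1500 * (n + 1)) ≤ 2 * ((n + 1) * (1800 + 1500 * n)) := by nlinarith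
    rw [pow_succ]
    nlinarith

/-- `S₃(g) ≤ 4·g³` for `g ≥ 1`. -/
theorem S3_le_four_pow_three {g : ℕ} (hg : 1 ≤ g) : S3 g ≤ 4 * g ^ 3 := by
  unfold S3
  have c2 := Nat.choose_le_pow g 2
  have c3 := Nat.choose_le_pow g 3
  have a : g ≤ g ^ 3 := by
    calc g = g ^ 1 := (pow_one g).symm
      _ ≤ g ^ 3 := Nat.pow_le_pow_right hg (by omega)
  have b : g ^ 2 ≤ g ^ 3 := Nat.pow_le_pow_right hg (by omega)
  have d : 1 ≤ g ^ 3 := Nat.one_le_pow _ _ hg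
  omega

/-- Lemma A: `F₃(g) ≥ (1799/1000)·2^g` for `g ≥ 101`. -/
theorem F3_ge {g : ℕ} (hg : 101 ≤ g) : (1799 / 1000 : ℚ) * 2 ^ g ≤ F3 g := by
  have h1 : (1000 : ℚ) * (g : ℚ) ^ 4 ≤ 2 ^ g := by exact_mod_cast two_pow_ge_thousand hg
  have hS3 : (S3 g : ℚ) ≤ 4 * (g : ℚ) ^ 3 := by exact_mod_cast S3_le_four_pow_three (by omega : 1 ≤ g)
  have hS2 : (0 : ℚ) ≤ (S2 g : ℚ) := by positivity
  have hC4 : (g.choose 4 : ℚ) ≤ (g : ℚ) ^ 4 / 24 := by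
    have := Nat.choose_le_pow_div (α := ℚ) 4 g
    simpa [Nat.factorial] using this
  have hg' : (8 : ℚ) ≤ g := by exact_mod_cast (by omega : 8 ≤ g)
  have h3 : (36 / 5 : ℚ) * (g : ℚ) ^ 3 ≤ 9 / 10 * (g : ℚ) ^ 4 := by nlinarith [pow_nonneg (by positivity : (0:ℚ) ≤ g) 3]
  unfold F3
  nlinarith [h1, hS3, hS2, hC4, h3]

/-- Lemma A₄: `Fg(g) ≥ (799/1000)·2^g` for `g ≥ 101`. -/
theorem Fg_ge {g : ℕ} (hg : 101 ≤ g) : (799 / 1000 : ℚ) * 2 ^ g ≤ Fg g := by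
  have h1 : (1000 : ℚ) * (g : ℚ) ^ 4 ≤ 2 ^ g := by exact_mod_cast two_pow_ge_thousand hg
  have hS3 : (0 : ℚ) ≤ (S3 g : ℚ) := by positivity
  have hC4 : (g.choose 4 : ℚ) ≤ (g : ℚ) ^ 4 / 24 := by
    have := Nat.choose_le_pow_div (α := ℚ) 4 g
    simpa [Nat.factorial] using this
  unfold Fg
  nlinarith [h1, hS3, hC4]

/-- `4·c^4 ≤ 2^c` for `c ≥ 23` (Regime II-b at `t = 4`). -/
theorem two_pow_ge_four_pow_four {c : ℕ} (hc : 23 ≤ c) : 4 * c ^ 4 ≤ 2 ^ c := by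
  induction c, hc using Nat.le_induction with
  | base => norm_num
  | succ n hn ih =>
    have := succ_pow_four_le (by omega : 15 ≤ n)
    rw [show (2 : ℕ) ^ (n + 1) = 2 * 2 ^ n by ring]
    omega

/-- Regime II-a at `t = 4`: `8160800·(c+1)·((5c − 2)·2^c + 12) ≤ 7830999·4^c` for `c ≥ 11`
(`200·40804 = 8160800`, `799·9801 = 7830999`). -/
theorem regII4_a {c : ℕ} (hc : 11 ≤ c) : 8160800 * ((c + 1) * ((5 * c - 2) * 2 ^ c + 12)) ≤ 7830999 * 4 ^ c := by
  induction c, hc using Nat.le_induction with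
  | base => norm_num
  | succ n hn ih =>
    have h5 : 5 * (n + 1) - 2 = (5 * n - 2) + 5 := by omega
    rw [h5, pow_succ, pow_succ]
    obtain ⟨x, hx⟩ : ∃ x, x = 5 * n - 2 := ⟨_, rfl⟩
    rw [← hx] at ih ⊢
    have h52 : 53 ≤ x := by omega
    have key : 10 * (n + 2) * 2 ^ n ≤ 2 * n * x * 2 ^ n := by
      apply Nat.mul_le_mul_right; nlinarith
    have h2 : (n + 2) * ((x + 5) * (2 ^ n * 2) + 12) ≤ 4 * ((n + 1) * (x * 2 ^ n + 12)) := by nlinarith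
    nlinarith

/-! ## The Regime-I helpers -/

/-- The price term alone: if `j ≥ j₀`, `A·2^p ≤ y_P·C(p,2)` and `K·(c + j₀) ≤ j₀·A`, then (S) holds. -/
theorem S_of_yterm {c j A K Q YP tp : ℚ} (j₀ : ℚ) (hj₀ : 0 < j₀) (hc : 0 < c) (hj : j₀ ≤ j)
    (hA : A * tp ≤ YP) (hK : K * (c + j₀) ≤ j₀ * A) (hQ : 0 ≤ Q) (htp : 0 ≤ tp) (hYP : 0 ≤ YP) :
    K * tp ≤ j / (c + j) * YP + Q := by
  have ht : j₀ / (c + j₀) ≤ j / (c + j) := by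
    rw [div_le_div_iff₀ (by linarith) (by linarith)]; nlinarith
  have h1 : K * tp ≤ j₀ / (c + j₀) * (A * tp) := by
    rw [show j₀ / (c + j₀) * (A * tp) = (j₀ * A) / (c + j₀) * tp by ring]
    apply mul_le_mul_of_nonneg_right _ htp
    rw [le_div_iff₀ (by linarith)]; linarith
  calc K * tp ≤ j₀ / (c + j₀) * (A * tp) := h1
    _ ≤ j₀ / (c + j₀) * YP := mul_le_mul_of_nonneg_left hA (by positivity)
    _ ≤ j / (c + j) * YP := mul_le_mul_of_nonneg_right ht hYP
    _ ≤ j / (c + j) * YP + Q := by linarith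

/-- `ρ ≥ ((99 − c)/100)²` for `g ≥ 101`, `c = g − p ≤ 10`: `(99 − c)²·C(g,2) ≤ 10000·C(p,2)`. -/
theorem rho_regI {g p c : ℕ} (hg : 101 ≤ g) (hc : c = g - p) (hc10 : c ≤ 10) (hpg : p + 3 ≤ g) :
    ((99 : ℚ) - c) ^ 2 * (g.choose 2 : ℚ) ≤ 10000 * (p.choose 2 : ℚ) := by
  rw [Nat.cast_choose_two ℚ g, Nat.cast_choose_two ℚ p]
  have hcq : (c : ℚ) = g - p := by rw [hc, Nat.cast_sub (by omega)]
  have hc10q : (c : ℚ) ≤ 10 := by exact_mod_cast hc10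
  have hgq : (101 : ℚ) ≤ g := by exact_mod_cast hg
  have hpq : (91 : ℚ) ≤ p := by exact_mod_cast (by omega : 91 ≤ p)
  have hc0 : (0 : ℚ) ≤ c := by positivity
  have hkey : (0 : ℚ) ≤ ((g : ℚ) - 100) * (c + 1) := mul_nonneg (by linarith) (by linarith)
  have h0q : ((99 : ℚ) - c) * g ≤ 100 * ((p : ℚ) - 1) := by nlinarith
  have hA : (0 : ℚ) ≤ ((99 : ℚ) - c) * g := mul_nonneg (by linarith) (by linarith)
  have hsq : (((99 : ℚ) - c) * g) ^ 2 ≤ (100 * ((p : ℚ) - 1)) ^ 2 := pow_le_pow_left₀ hA h0q 2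
  nlinarith

/-- The `δ`-term bounds for `m ≥ 12` (Lemmas B, C and `ε ≥ δ`). -/
theorem delta_bounds {m : ℕ} (hm12 : 12 ≤ m) :
    (927 / 1000 : ℚ) * 2 ^ m ≤ (delta m : ℚ) ∧ (m.choose 4 : ℚ) ≤ 131 / 1000 * (delta m : ℚ) ∧
      (delta m : ℚ) ≤ (eps m : ℚ) := by
  refine ⟨?_, ?_, ?_⟩
  · have e : ((927 * 2 ^ m : ℕ) : ℚ) ≤ ((1000 * delta m : ℕ) : ℚ) := by exact_mod_cast delta_ge_927 hm12
    push_cast at e; linarith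
  · have e : ((10000 * m.choose 4 : ℕ) : ℚ) ≤ ((1214 * 2 ^ m : ℕ) : ℚ) := by exact_mod_cast choose_four_le_1214 hm12
    have e2 : ((927 * 2 ^ m : ℕ) : ℚ) ≤ ((1000 * delta m : ℕ) : ℚ) := by exact_mod_cast delta_ge_927 hm12
    push_cast at e e2; linarith
  · rw [eps_cast]; linarith [show (0 : ℚ) ≤ (m.choose 3 : ℚ) by positivity]

end PercRepro.SixFour
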